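/-
Copyright: the b2b-balaban T⁴-continuum CRUX team, row NE7b OWNER lineage `t4-ne7b-p1` (gen 134). Project licence.
-/
import Summits.QuantumFields.BalabanUV.T4Continuum.Spine.NE7b.SupPolymerLocalStep

/-!
# THE OUTPUT LETTER IS A SMALL-FIELD SUP LETTER ON THE SUPPORT: (355) bounded the support term `K⁺_Y(ψ)` of the next potential for external fields
# small on ALL singleton members of `𝒳`; by (355)'s LOCALITY the term sees `ψ` only on the cells of `Y`, so replacing `ψ` by its CUT-OFF to the
# cells of `Y` (which is globally small as soon as `ψ` is small on the singleton members INSIDE `Y`, the cells being disjoint) gives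
#   `Σ_{cell p}ψ² ≤ Ψ²` for the singletons `{p} ∈ 𝒳` with `p ∈ Y`   ⟹   `‖K⁺_Y(ψ)‖ ≤ e^{−τ₂#Y}·(Δ+1)·2e^{1+τ₂}ε′`,
# with NO condition on `ψ` off `Y` — exactly the INPUT-TYPE letter of a non-singleton factor of the NEXT step: a sup bound on the SMALL-FIELD REGION
# of its own support (times the region's characteristic function it becomes the global sup letter `hsup` of (355)); SCOPING-d6 (L3) made precise
# (row NE7b, node U5c; (355)'s `step_supportTerm_local` + `step_norm_supportTerm_le` BY NAME, one cut-off field; [folklore])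

Cell `pub-balaban`, sub-cell `t4`, spine estimate NE7b (`T4WeightBudget.RelWeightBound`; the cell's OWN estimate — NOT PRINTED in
[Bałaban 1983–89], NOT PROVED).  Crux-route work under `Spine/NE7b/` by the row OWNER (`t4-ne7b-p1` gen 134, file (363)) under FREEZE
(0)'s crux-prover clause, on `g134/records/SCOPING-d6-iteration.md` (L3); NOTHING of Bałaban's is named as a Lean object, valued or asserted; no
`T4Continuum/Support` leaf typed; no `def`, no notation; zero `sorry`.  Imports (BY NAME): the OWNER's (355) `…SupPolymerLocalStep`
(`step_supportTerm_local`, `step_norm_supportTerm_le`); Mathlib's `WithLp.toLp`, `Finset.card_eq_one`, `Finset.singleton_biUnion`.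

WHAT IS PROVED ([folklore]; `ψ^Y := ψ·1_{⋃_{p∈Y}cell p}` written `WithLp.toLp 2 (fun x => if x ∈ Y.biUnion cell then ψ x else 0)`):
* §1 the cut-off field: `cutoffField_apply`, `cutoffField_eq_on` (`ψ^Y = ψ` on the cells of `Y`), `cutoffField_eq_zero_off` (disjoint cells: `ψ^Y = 0` on
  the cells of `p ∉ Y`), **`cutoffField_small`** (`ψ` small on the singleton members inside `Y` ⟹ `ψ^Y` small on ALL singleton members);
* §2 THE END **`outputLetter_of_small_on_support`** (the displayed bound on `‖K⁺_Y(ψ)‖` for every `ψ` small on the singleton members inside `Y`,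
  factors local in the field); §3 toy.

HONEST (what this is NOT).  A corollary of (355) (same sites, same Gaussian, same constants); the large-field COMPLEMENT of the region (where the next
factor is `e^{K⁺_Y}·1_{large} `, not small) is routed to (304)–(309)∕(343)–(344) and not typed here; measurability of `ψ ↦ K⁺_Y(ψ)` (L5) not typed;
scalar skeleton ((A3), NC-NE7b-α UNRULED); nothing of Bałaban's asserted.  BY-NAME EFFECT ON THE WALL: NONE.  NE7b NOT PRINTED ∕ NOT PROVED; spine
PROVED 0∕9; rung (B)+1 — the programme's measures remain FINITE-torus statements; NOT the mass gap, NOT Clay.  HONEST DEPENDENCY: continuum YM on T⁴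
⇐ BetaPertH ∧ nine spine estimates (0∕9 proved); BetaPertH ⇐ (D1) ∧ (D4) ∧ CAP+tail; G-an2-4 gates asym, D1 and NE2∕3∕4.
-/

set_option autoImplicit false

noncomputable section

namespace Summit.QuantumFields.BalabanUV.T4Continuum.NE7b.SupOutputSmallFieldLetter

open MeasureTheory ProbabilityTheory Finset Real
open scoped BigOperators
open Literature.Probability.LatticeModels
open Literature.Analysis.Matrix (HasFiniteRange)
open SupPolymerLocalStep (step_supportTerm_local step_norm_supportTerm_le)

variable {V : Type*} [DecidableEq V] {R : V → V → Prop} [DecidableRel R] {nbr : V → Finset V} {Δ : ℕ}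
variable {ι : Type} [Fintype ι] [DecidableEq ι]

/-! ## §1. The cut-off external field -/

omit [DecidableEq V] [DecidableRel R] [Fintype ι] in
/-- The cut-off field evaluated. [folklore] -/
theorem cutoffField_apply (cell : V → Finset ι) (Y : Finset V) (ψ : EuclideanSpace ℝ ι) (x : ι) :
    (WithLp.toLp 2 (fun x => if x ∈ Y.biUnion cell then ψ x else 0) : EuclideanSpace ℝ ι) x =
      if x ∈ Y.biUnion cell then ψ x else 0 := rfl

omit [DecidableEq V] [DecidableRel R] [Fintype ι] in
/-- **The cut-off field agrees with `ψ` on the cells of `Y`.** [folklore] -/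
theorem cutoffField_eq_on (cell : V → Finset ι) (Y : Finset V) (ψ : EuclideanSpace ℝ ι) :
    ∀ p ∈ Y, ∀ x ∈ cell p, ψ x = (WithLp.toLp 2 (fun x => if x ∈ Y.biUnion cell then ψ x else 0) : EuclideanSpace ℝ ι) x := by
  intro p hp x hx
  rw [cutoffField_apply, if_pos (mem_biUnion.2 ⟨p, hp, hx⟩)]

omit [DecidableEq V] [DecidableRel R] [Fintype ι] in
/-- **Disjoint cells: the cut-off field vanishes on the cells of the other cells' owners.** [folklore] -/
theorem cutoffField_eq_zero_off (cell : V → Finset ι) (hdisj : ∀ p q, p ≠ q → Disjoint (cell p) (cell q)) (Y : Finset V)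
    (ψ : EuclideanSpace ℝ ι) {p : V} (hp : p ∉ Y) {x : ι} (hx : x ∈ cell p) :
    (WithLp.toLp 2 (fun x => if x ∈ Y.biUnion cell then ψ x else 0) : EuclideanSpace ℝ ι) x = 0 := by
  rw [cutoffField_apply, if_neg]
  intro hxY
  obtain ⟨q, hq, hxq⟩ := mem_biUnion.1 hxY
  have hpq : p ≠ q := fun h => hp (h ▸ hq)
  exact Finset.disjoint_left.1 (hdisj p q hpq) hx hxq

omit [DecidableRel R] [Fintype ι] in
/-- **SMALL ON THE SINGLETONS INSIDE `Y` ⟹ THE CUT-OFF FIELD IS SMALL ON ALL SINGLETONS** (disjoint cells). [folklore] -/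
theorem cutoffField_small (cell : V → Finset ι) (hdisj : ∀ p q, p ≠ q → Disjoint (cell p) (cell q)) (𝒳 : Finset (Finset V)) (Y : Finset V)
    (ψ : EuclideanSpace ℝ ι) {Ψ : ℝ} (hψY : ∀ X ∈ 𝒳, X.card = 1 → X ⊆ Y → ∑ x ∈ X.biUnion cell, ψ x ^ 2 ≤ Ψ ^ 2) :
    ∀ X ∈ 𝒳, X.card = 1 →
      ∑ x ∈ X.biUnion cell, (WithLp.toLp 2 (fun x => if x ∈ Y.biUnion cell then ψ x else 0) : EuclideanSpace ℝ ι) x ^ 2 ≤ Ψ ^ 2 := by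
  intro X hX hX1
  obtain ⟨p, rfl⟩ := card_eq_one.1 hX1
  by_cases hp : p ∈ Y
  · have hsub : ({p} : Finset V) ⊆ Y := singleton_subset_iff.2 hp
    refine le_trans (le_of_eq (sum_congr rfl fun x hx => ?_)) (hψY {p} hX hX1 hsub)
    rw [singleton_biUnion] at hx
    rw [← cutoffField_eq_on cell Y ψ p hp x hx]
  · calc ∑ x ∈ ({p} : Finset V).biUnion cell,
          (WithLp.toLp 2 (fun x => if x ∈ Y.biUnion cell then ψ x else 0) : EuclideanSpace ℝ ι) x ^ 2 = ∑ x ∈ ({p} : Finset V).biUnion cell, (0 : ℝ) := by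
            refine sum_congr rfl fun x hx => ?_
            rw [singleton_biUnion] at hx
            rw [cutoffField_eq_zero_off cell hdisj Y ψ hp hx]
            ring
      _ = 0 := sum_const_zero
      _ ≤ Ψ ^ 2 := sq_nonneg Ψ

/-! ## §2. THE END: the output letter under smallness on the support only -/

/-- **THE OUTPUT LETTER IS A SMALL-FIELD SUP LETTER ON THE SUPPORT.**  Under the hypotheses of (355)'s `step_norm_supportTerm_le` EXCEPT that the external
field `ψ` is only assumed small on the cells of the singleton members of `𝒳` INSIDE `Y` (`Σ_{cell p}ψ² ≤ Ψ²` for `{p} ∈ 𝒳`, `p ∈ Y`), and with the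
factors local in the field (`ψ = ψ'` on the cells of `X` ⟹ `f_X(ω+ψ) = f_X(ω+ψ')`):
`‖K⁺_Y(ψ)‖ ≤ e^{−τ₂#Y}·(Δ+1)·2e^{1+τ₂}ε′`, `ε′ = √ε″e^{2√ε″}`, `ε″ = εe^{½κ(1+τ⁻¹)Ψ²}A_τ^v` — the sup letter of the next step's factor on its OWN
small-field region. [folklore] -/
theorem outputLetter_of_small_on_support {Γ : Matrix ι ι ℝ} {γop γ : ℝ} (hΓ : Γ.PosSemidef) (hΓop : (γop • (1 : Matrix ι ι ℝ) - Γ).PosSemidef)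
    (hdiag : ∀ i, Γ i i ≤ γ) (hγ : 0 ≤ γ) (cell : V → Finset ι) (hdisj : ∀ p q, p ≠ q → Disjoint (cell p) (cell q)) {v : ℕ}
    (hv : ∀ p, (cell p).card ≤ v) (hRsymm : ∀ x y, R x y → R y x) (hΔ : ∀ x, (nbr x).card ≤ Δ) (hnbr : ∀ x y, R x y → y ∈ nbr x)
    {f : Finset V → EuclideanSpace ℝ ι → ℂ} {ε κ τ θ Ψ : ℝ} (hε : 0 ≤ ε) (hκ : 0 ≤ κ) (hτ : 0 < τ)
    (hθ0 : 0 < θ) (hθ1 : θ < 1) (hκθ : κ * (1 + τ) * γop ≤ θ) (𝒳 : Finset (Finset V)) (hconn : ∀ X ∈ 𝒳, IsRConnected R X)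
    (hreg : ∀ X ∈ 𝒳, X.card = 1 → ∀ ω : EuclideanSpace ℝ ι, ‖f X ω‖ ≤ ε ^ X.card * exp (κ * (∑ x ∈ X.biUnion cell, ω x ^ 2) / 2))
    (hsup : ∀ X ∈ 𝒳, X.card ≠ 1 → ∀ ω : EuclideanSpace ℝ ι, ‖f X ω‖ ≤ ε ^ X.card)
    (hloc : ∀ X ∈ 𝒳, ∀ (ω ψ ψ' : EuclideanSpace ℝ ι), (∀ p ∈ X, ∀ x ∈ cell p, ψ x = ψ' x) → f X (ω + ψ) = f X (ω + ψ'))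
    {τ₂ : ℝ} (hτ₂ : 0 ≤ τ₂)
    (hsmall : Real.exp (1 + τ₂) * (Real.sqrt ((ε * exp (κ * (1 + τ⁻¹) * Ψ ^ 2 / 2)) * ((1 - θ) ^ (-(κ * (1 + τ) * γ / (2 * θ)))) ^ v) *
      Real.exp (2 * Real.sqrt ((ε * exp (κ * (1 + τ⁻¹) * Ψ ^ 2 / 2)) * ((1 - θ) ^ (-(κ * (1 + τ) * γ / (2 * θ)))) ^ v))) *
      ((Δ : ℝ) + 1) ^ 2 ≤ 1 / 2) {Y : Finset V} (hY : Y.Nonempty) (ψ : EuclideanSpace ℝ ι)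
    (hψY : ∀ X ∈ 𝒳, X.card = 1 → X ⊆ Y → ∑ x ∈ X.biUnion cell, ψ x ^ 2 ≤ Ψ ^ 2) :
    ‖∑ 𝒞 ∈ ((rconnSubsets (Touches R) 𝒳).image fun 𝒜 => 𝒜.biUnion id).powerset with 𝒞.biUnion id = Y,
        truncatedWeight (GeomInc R) (pushforwardActivity (fun 𝒜 : Finset (Finset V) => 𝒜.biUnion id)
          (cellActivity (multivariateGaussian 0 Γ) fun X ω => f X (ω + ψ)) (rconnSubsets (Touches R) 𝒳)) 𝒞‖ ≤
      Real.exp (-(τ₂ * Y.card)) * (((Δ : ℝ) + 1) * (2 * (Real.exp (1 + τ₂) *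
        (Real.sqrt ((ε * exp (κ * (1 + τ⁻¹) * Ψ ^ 2 / 2)) * ((1 - θ) ^ (-(κ * (1 + τ) * γ / (2 * θ)))) ^ v) *
          Real.exp (2 * Real.sqrt ((ε * exp (κ * (1 + τ⁻¹) * Ψ ^ 2 / 2)) * ((1 - θ) ^ (-(κ * (1 + τ) * γ / (2 * θ)))) ^ v)))))) := by
  -- replace `ψ` by its cut-off to the cells of `Y` (locality), which is globally small
  rw [step_supportTerm_local (R := R) (multivariateGaussian 0 Γ) cell 𝒳 hloc Y (cutoffField_eq_on cell Y ψ)]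
  exact step_norm_supportTerm_le hΓ hΓop hdiag hγ cell hdisj hv hRsymm hΔ hnbr hε hκ hτ hθ0 hθ1 hκθ 𝒳 hconn hreg hsup _
    (cutoffField_small cell hdisj 𝒳 Y ψ hψY) hτ₂ hsmall hY

/-! ## §3. Toy -/

omit [DecidableRel R] [Fintype ι] in
/-- Toy (§1): the cut-off to the EMPTY cell set is the zero field. -/
example (cell : V → Finset ι) (ψ : EuclideanSpace ℝ ι) (x : ι) :
    (WithLp.toLp 2 (fun x => if x ∈ (∅ : Finset V).biUnion cell then ψ x else 0) : EuclideanSpace ℝ ι) x = 0 := by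
  rw [cutoffField_apply]; simp

end Summit.QuantumFields.BalabanUV.T4Continuum.NE7b.SupOutputSmallFieldLetter
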